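import Literature.NumberTheory.NumberFields.PureCubicDegreeOnePrimes
import HarnessLib

/-!
# Pure cubic fields `ℚ(∛(ab²))`: Dedekind's order `ℤ + ℤθ + ℤθ²/b` has index dividing `3`

Topic `NumberTheory/NumberFields`, sub-namespace `PureCubic` (continuation of
`PureCubicDegreeOnePrimes.lean`, through the `MonicCubic` API at `a = b = 0`, `c = -m`).
Every cube-free `m ≥ 2` is `m = ab²` with `ab` squarefree, `ab ≠ 1`. Let `K` be a number field
of degree `3`, `θ ∈ K`, `θ³ = ab²`, `θ₂ = θ²/b`; then `θ₂³ = a²b`, `θ² = bθ₂`, `θ₂² = aθ`,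
`θθ₂ = ab`, and `𝒪 = ℤ + ℤθ + ℤθ₂` is Dedekind's order (`= 𝓞 K` unless `a²b⁴ ≡ 1 (mod 9)`,
when its index is `3`). PROVED (Dedekind 1900; Alaca–Williams Thm. 7.3.2; Cohen GTM 138,
§6.4.3; Marcus Ch. 2, Ex. 41, Ch. 3, Thm. 27):
* `MonicCubic.mem_adjoin_of_eisenstein_dvd` (Eisenstein peeling at several primes):
  `d x ∈ ℤ[θ] ⟹ x ∈ ℤ[θ]` when the cubic is Eisenstein at every prime factor of `d`;
* `not_cube`, `isEisensteinAt_of_dvd` (`X³ - ab²` is Eisenstein at the primes of `a`), the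
  relations above, `isIntegral_theta`, `isIntegral_theta₂`, `norm_lin_pure`, `trace_lin_pure`,
  and in the basis `1, θ, θ₂`: `norm_order` (`N = x³ + ab²y³ + a²bz³ - 3ab·xyz`),
  `trace_order` (`Tr = 3x`), `coords_eq_zero` (`ℚ`-linear independence);
* `mul_mem_adjoin_of_dvd`: `N · 𝓞 K ⊆ ℤ[θ]` if `dN = 27a²b⁴ = -disc(1, θ, θ²)` and the primes
  of `d` divide `a`;
* **`three_mul_mem_order`: `3 · 𝓞 K ⊆ 𝒪`.** From the previous item for `θ` and for `θ₂`:
  `27b⁴ · 𝓞 K ⊆ ℤ[θ] ⊆ 𝒪`, `27a⁴ · 𝓞 K ⊆ ℤ[θ₂] ⊆ 𝒪`, so `27 · 𝓞 K ⊆ 𝒪` (Bézout), and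
  `𝓞 K ⊆ 𝒪` if `3 ∣ ab` (Eisenstein at `3`); if `3 ∤ ab` and `27ξ = x + yθ + zθ₂`, the traces
  `Tr ξ = x/9`, `Tr(θξ) = abz/9`, `Tr(θ₂ξ) = aby/9` are integers, so `9 ∣ x, y, z`.

NOT here: the exact ring of integers and `d_K ∈ {-27a²b², -3a²b²}`.

## References

* S. Alaca, K. S. Williams, *Introductory Algebraic Number Theory*, CUP (2003), Thm. 7.3.2.
  [cite: AlacaWilliams2003, Thm. 7.3.2]
* H. Cohen, *A Course in Computational Algebraic Number Theory*, GTM 138 (1993), §6.4.3.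
* D. A. Marcus, *Number Fields*, 2nd ed. (2018), Ch. 2, Ex. 41; Ch. 3, Thm. 27.
* R. Dedekind, *Über die Anzahl der Idealklassen in reinen kubischen Zahlkörpern*, J. reine
  angew. Math. 121 (1900), 40–123.
-/

noncomputable section

open Polynomial Module NumberField
open scoped NumberField

namespace Literature.NumberTheory.NumberFields

variable {K : Type*} [Field K] [NumberField K]

omit [NumberField K] in
/-- `((N : 𝓞 K) · ξ : K) = N · ξ` for the coercion `𝓞 K → K`. [folklore] -/
theorem coe_natCast_mul_ringOfIntegers (N : ℕ) (ξ : 𝓞 K) :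
    (((N : 𝓞 K) * ξ : 𝓞 K) : K) = (N : K) * ξ := by
  rw [RingOfIntegers.coe_eq_algebraMap, map_mul, map_natCast]

namespace MonicCubic

variable {a b c : ℤ} {θ : K}

/-- **Eisenstein peeling at several primes.** If the irreducible monic cubic `f` with root `θ`
generating the cubic field `K` is Eisenstein at every prime factor of `d ≠ 0`, then
`d x ∈ ℤ[θ] ⟹ x ∈ ℤ[θ]` for every algebraic integer `x` (iterate `mem_adjoin_of_eisenstein`
along a prime factorisation of `d`). [cite: Marcus2018, Ch. 3, Thm. 27] -/
theorem mem_adjoin_of_eisenstein_dvd (h3 : finrank ℚ K = 3) (hirr : Irreducible (polyQ a b c))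
    (hθ : aeval θ (poly a b c) = 0) {d : ℕ} (hd : d ≠ 0)
    (heis : ∀ p : ℕ, p.Prime → p ∣ d → (poly a b c).IsEisensteinAt (Ideal.span {(p : ℤ)}))
    {x : 𝓞 K} (hx : (d : K) * x ∈ Algebra.adjoin ℤ ({θ} : Set K)) :
    (x : K) ∈ Algebra.adjoin ℤ ({θ} : Set K) := by
  induction d using UniqueFactorizationMonoid.induction_on_prime generalizing x with
  | h₁ => exact absurd rfl hd
  | h₂ d hu =>
    rw [Nat.isUnit_iff.mp hu, Nat.cast_one, one_mul] at hx
    exact hx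
  | h₃ d p hd0 hp ih =>
    have hp' : p.Prime := Nat.prime_iff.mpr hp
    have hθ' : aeval (θ - ((0 : ℤ) : K)) (poly a b c) = 0 := by simpa using hθ
    have hx' : (p : K) ^ 1 * ↑((d : 𝓞 K) * x) ∈ Algebra.adjoin ℤ ({θ} : Set K) := by
      rw [pow_one, coe_natCast_mul_ringOfIntegers, ← mul_assoc, ← Nat.cast_mul]
      exact hx
    have key := mem_adjoin_of_eisenstein h3 hirr hθ' hp' (heis p hp' (Dvd.intro d rfl)) hx'
    rw [coe_natCast_mul_ringOfIntegers] at key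
    exact ih hd0 (fun q hq hqd => heis q hq (hqd.mul_left p)) key

end MonicCubic

namespace PureCubic

open MonicCubic

variable {m a b : ℕ} {θ : K}

omit [NumberField K] in
/-- `θ³ = m` makes `θ` a root of `MonicCubic.poly 0 0 (-m) = X³ - m`. [folklore] -/
theorem aeval_poly_of_cube_eq (hθ : θ ^ 3 = (m : K)) : aeval θ (poly 0 0 (-(m : ℤ))) = 0 := by
  simp [poly, hθ]

omit [NumberField K] in
/-- A cube root `θ` of `m : ℕ` is an algebraic integer. [folklore] -/
theorem isIntegral_theta (hθ : θ ^ 3 = (m : K)) : IsIntegral ℤ θ :=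
  isIntegral_of_aeval (aeval_poly_of_cube_eq hθ)

/-- **Norm form of `ℚ(∛m)` in `1, θ, θ²`**: `N(x + yθ + zθ²) = x³ + my³ + m²z³ - 3mxyz`
(determinant of `x + yC + zC²`, `C` the companion matrix of `X³ - m`; classical, e.g. Cohen,
GTM 138, §6.4.3). [folklore] -/
theorem norm_lin_pure (h3 : finrank ℚ K = 3) (hm : ∀ r : ℕ, r ^ 3 ≠ m) (hθ : θ ^ 3 = (m : K))
    (x y z : ℚ) :
    Algebra.norm ℚ ((x : K) + (y : K) * θ + (z : K) * θ ^ 2) =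
      x ^ 3 + m * y ^ 3 + (m : ℚ) ^ 2 * z ^ 3 - 3 * m * x * y * z := by
  rw [norm_lin (irreducible_polyQ hm) (aeval_poly_of_cube_eq hθ) h3, normForm]
  push_cast
  ring

/-- **Trace form of `ℚ(∛m)` in `1, θ, θ²`**: `Tr(x + yθ + zθ²) = 3x` (`Tr θ = Tr θ² = 0`).
[folklore] -/
theorem trace_lin_pure (h3 : finrank ℚ K = 3) (hm : ∀ r : ℕ, r ^ 3 ≠ m)
    (hθ : θ ^ 3 = (m : K)) (x y z : ℚ) :
    Algebra.trace ℚ K ((x : K) + (y : K) * θ + (z : K) * θ ^ 2) = 3 * x := by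
  rw [trace_lin (irreducible_polyQ hm) (aeval_poly_of_cube_eq hθ) h3]
  push_cast
  ring

/-- If `ab` is squarefree then `a ≠ 0` and `b ≠ 0`. [folklore] -/
theorem ne_zero_of_squarefree_mul (hab : Squarefree (a * b)) : a ≠ 0 ∧ b ≠ 0 :=
  ⟨left_ne_zero_of_mul hab.ne_zero, right_ne_zero_of_mul hab.ne_zero⟩

/-- **`ab²` is not a cube** for `ab` squarefree, `ab ≠ 1`: at a prime `p ∣ ab` the exponent of
`p` in `ab²` is `1` or `2`. [folklore] -/
theorem not_cube (hab : Squarefree (a * b)) (hab1 : a * b ≠ 1) (r : ℕ) :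
    r ^ 3 ≠ a * b ^ 2 := by
  intro hr
  obtain ⟨ha0, hb0⟩ := ne_zero_of_squarefree_mul hab
  obtain ⟨p, hp, hpab⟩ := Nat.exists_prime_and_dvd hab1
  have h1 : (a * b).factorization p ≤ 1 := hab.natFactorization_le_one p
  have h2 : 0 < (a * b).factorization p :=
    hp.factorization_pos_of_dvd (mul_ne_zero ha0 hb0) hpab
  have key := congrArg (fun n => n.factorization p) hr
  simp only [Nat.factorization_pow, Nat.factorization_mul ha0 (pow_ne_zero 2 hb0),
    Finsupp.smul_apply, Finsupp.add_apply, smul_eq_mul] at key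
  rw [Nat.factorization_mul ha0 hb0, Finsupp.add_apply] at h1 h2
  omega

/-- **`X³ - ab²` is Eisenstein at every prime `p ∣ a`** (`p ∣ ab²`, and `p² ∤ ab²` since
`p ∤ b` and `p² ∤ a`). [folklore] -/
theorem isEisensteinAt_of_dvd (hab : Squarefree (a * b)) {p : ℕ} (hp : p.Prime) (hpa : p ∣ a) :
    (poly 0 0 (-((a * b ^ 2 : ℕ) : ℤ))).IsEisensteinAt (Ideal.span {(p : ℤ)}) := by
  obtain ⟨hcop, ha, -⟩ := Nat.squarefree_mul_iff.mp hab
  have hpb : p.Coprime b := hcop.coprime_dvd_left hpa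
  refine isEisensteinAt_poly hp (dvd_zero _) (dvd_zero _) ?_ ?_
  · rw [dvd_neg]
    exact_mod_cast hpa.mul_right (b ^ 2)
  · rw [dvd_neg]
    intro h
    have h' : p ^ 2 ∣ a * b ^ 2 := by exact_mod_cast h
    have h'' : p ^ 2 ∣ a := (Nat.Coprime.pow 2 2 hpb).dvd_of_dvd_mul_right h'
    exact hp.ne_one (Nat.isUnit_iff.mp (ha p (by rw [← sq]; exact h'')))

/-- `θ₂ = θ²/b` is a cube root of `ba²`: `θ₂³ = θ⁶/b³ = a²b⁴/b³`. [folklore] -/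
theorem theta₂_pow_three (hab : Squarefree (a * b)) (hθ : θ ^ 3 = ((a * b ^ 2 : ℕ) : K)) :
    (θ ^ 2 / (b : K)) ^ 3 = ((b * a ^ 2 : ℕ) : K) := by
  have hb : (b : K) ≠ 0 := Nat.cast_ne_zero.mpr (ne_zero_of_squarefree_mul hab).2
  push_cast at hθ ⊢
  rw [div_pow, div_eq_iff (pow_ne_zero 3 hb), show (θ ^ 2) ^ 3 = (θ ^ 3) ^ 2 by ring, hθ]
  ring

/-- `θ₂² = aθ` (`θ⁴ = ab²θ`). [folklore] -/
theorem theta₂_sq (hab : Squarefree (a * b)) (hθ : θ ^ 3 = ((a * b ^ 2 : ℕ) : K)) :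
    (θ ^ 2 / (b : K)) ^ 2 = (a : K) * θ := by
  have hb : (b : K) ≠ 0 := Nat.cast_ne_zero.mpr (ne_zero_of_squarefree_mul hab).2
  push_cast at hθ
  rw [div_pow, div_eq_iff (pow_ne_zero 2 hb), show (θ ^ 2) ^ 2 = θ * θ ^ 3 by ring, hθ]
  ring

/-- `θθ₂ = ab` (`θ³/b = ab²/b`). [folklore] -/
theorem theta_mul_theta₂ (hab : Squarefree (a * b)) (hθ : θ ^ 3 = ((a * b ^ 2 : ℕ) : K)) :
    θ * (θ ^ 2 / (b : K)) = ((a * b : ℕ) : K) := by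
  have hb : (b : K) ≠ 0 := Nat.cast_ne_zero.mpr (ne_zero_of_squarefree_mul hab).2
  push_cast at hθ ⊢
  rw [mul_div_assoc', div_eq_iff hb, show θ * θ ^ 2 = θ ^ 3 by ring, hθ]
  ring

/-- `θ² = bθ₂`. [folklore] -/
theorem theta_sq (hab : Squarefree (a * b)) : θ ^ 2 = (b : K) * (θ ^ 2 / (b : K)) := by
  rw [mul_div_cancel₀ _ (Nat.cast_ne_zero.mpr (ne_zero_of_squarefree_mul hab).2)]

/-- `θ₂ = θ²/b` is an algebraic integer (a root of `X³ - ba²`).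
[cite: AlacaWilliams2003, Thm. 7.3.2] -/
theorem isIntegral_theta₂ (hab : Squarefree (a * b)) (hθ : θ ^ 3 = ((a * b ^ 2 : ℕ) : K)) :
    IsIntegral ℤ (θ ^ 2 / (b : K)) :=
  isIntegral_theta (theta₂_pow_three hab hθ)

/-- A rational multiple of `θ₂` is one of `θ²`: `z · θ²/b = (z/b) · θ²`. [folklore] -/
theorem ratCast_mul_theta₂ (z : ℚ) (b : ℕ) (θ : K) :
    (z : K) * (θ ^ 2 / (b : K)) = ((z / b : ℚ) : K) * θ ^ 2 := by
  rw [Rat.cast_div, Rat.cast_natCast]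
  ring

/-- **Norm form in Dedekind's basis `1, θ, θ₂`**:
`N(x + yθ + zθ₂) = x³ + ab²y³ + a²bz³ - 3ab·xyz`. [folklore] -/
theorem norm_order (h3 : finrank ℚ K = 3) (hab : Squarefree (a * b)) (hab1 : a * b ≠ 1)
    (hθ : θ ^ 3 = ((a * b ^ 2 : ℕ) : K)) (x y z : ℚ) :
    Algebra.norm ℚ ((x : K) + (y : K) * θ + (z : K) * (θ ^ 2 / (b : K))) =
      x ^ 3 + (a * b ^ 2 : ℕ) * y ^ 3 + (a ^ 2 * b : ℕ) * z ^ 3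
        - 3 * (a * b : ℕ) * x * y * z := by
  have hb : (b : ℚ) ≠ 0 := Nat.cast_ne_zero.mpr (ne_zero_of_squarefree_mul hab).2
  rw [ratCast_mul_theta₂, norm_lin_pure h3 (not_cube hab hab1) hθ]
  push_cast
  field_simp

/-- **Trace form in Dedekind's basis `1, θ, θ₂`**: `Tr(x + yθ + zθ₂) = 3x`. [folklore] -/
theorem trace_order (h3 : finrank ℚ K = 3) (hab : Squarefree (a * b)) (hab1 : a * b ≠ 1)
    (hθ : θ ^ 3 = ((a * b ^ 2 : ℕ) : K)) (x y z : ℚ) :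
    Algebra.trace ℚ K ((x : K) + (y : K) * θ + (z : K) * (θ ^ 2 / (b : K))) = 3 * x := by
  rw [ratCast_mul_theta₂, trace_lin_pure h3 (not_cube hab hab1) hθ]

/-- **`1, θ, θ₂` are linearly independent over `ℚ`** (`X³ - ab²` is irreducible, so `1, θ, θ²`
is a basis of the cubic field `K`). [cite: AlacaWilliams2003, Thm. 7.3.2] -/
theorem coords_eq_zero (h3 : finrank ℚ K = 3) (hab : Squarefree (a * b)) (hab1 : a * b ≠ 1)
    (hθ : θ ^ 3 = ((a * b ^ 2 : ℕ) : K)) {c₀ c₁ c₂ : ℚ}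
    (h : (c₀ : K) + (c₁ : K) * θ + (c₂ : K) * (θ ^ 2 / (b : K)) = 0) :
    c₀ = 0 ∧ c₁ = 0 ∧ c₂ = 0 := by
  have hb : (b : ℚ) ≠ 0 := Nat.cast_ne_zero.mpr (ne_zero_of_squarefree_mul hab).2
  rw [ratCast_mul_theta₂] at h
  have key := coords_unique (irreducible_polyQ (not_cube hab hab1)) (aeval_poly_of_cube_eq hθ)
    h3 (u := c₀) (v := c₁) (w := c₂ / b) (u' := 0) (v' := 0) (w' := 0)
    (by rw [h]; push_cast; ring)
  exact ⟨key.1, key.2.1, (div_eq_zero_iff.mp key.2.2).resolve_right hb⟩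

/-- Elements of `ℤ[θ]` lie in `ℤ + ℤθ + ℤθ₂` (`θ² = bθ₂`). [folklore] -/
theorem exists_coords_of_mem_adjoin_theta (hab : Squarefree (a * b))
    (hθ : θ ^ 3 = ((a * b ^ 2 : ℕ) : K)) {w : K} (hw : w ∈ Algebra.adjoin ℤ ({θ} : Set K)) :
    ∃ c₀ c₁ c₂ : ℤ, w = c₀ + c₁ * θ + c₂ * (θ ^ 2 / (b : K)) := by
  obtain ⟨u, v, w', rfl⟩ := exists_coords_of_mem_adjoin (aeval_poly_of_cube_eq hθ) hw
  refine ⟨u, v, w' * b, ?_⟩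
  push_cast
  linear_combination (w' : K) * theta_sq (K := K) (θ := θ) hab

/-- Elements of `ℤ[θ₂]` lie in `ℤ + ℤθ + ℤθ₂` (`θ₂² = aθ`). [folklore] -/
theorem exists_coords_of_mem_adjoin_theta₂ (hab : Squarefree (a * b))
    (hθ : θ ^ 3 = ((a * b ^ 2 : ℕ) : K)) {w : K}
    (hw : w ∈ Algebra.adjoin ℤ ({θ ^ 2 / (b : K)} : Set K)) :
    ∃ c₀ c₁ c₂ : ℤ, w = c₀ + c₁ * θ + c₂ * (θ ^ 2 / (b : K)) := by
  obtain ⟨u, v, w', rfl⟩ :=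
    exists_coords_of_mem_adjoin (aeval_poly_of_cube_eq (theta₂_pow_three hab hθ)) hw
  refine ⟨u, w' * a, v, ?_⟩
  rw [theta₂_sq hab hθ]
  push_cast
  ring

omit [NumberField K] in
/-- **Bézout step**: if `gN₁ · η` and `gN₂ · η` lie in `ℤ + ℤθ + ℤθ₂` with `N₁, N₂` coprime, so
does `g · η`. [folklore] -/
theorem of_coprime_mul {θ₂ η : K} {N₁ N₂ g : ℕ} (hcop : Nat.Coprime N₁ N₂)
    (h₁ : ∃ c₀ c₁ c₂ : ℤ, ((g * N₁ : ℕ) : K) * η = c₀ + c₁ * θ + c₂ * θ₂)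
    (h₂ : ∃ c₀ c₁ c₂ : ℤ, ((g * N₂ : ℕ) : K) * η = c₀ + c₁ * θ + c₂ * θ₂) :
    ∃ c₀ c₁ c₂ : ℤ, (g : K) * η = c₀ + c₁ * θ + c₂ * θ₂ := by
  obtain ⟨u, v, huv⟩ := Nat.isCoprime_iff_coprime.mpr hcop
  obtain ⟨c₀, c₁, c₂, hc⟩ := h₁
  obtain ⟨d₀, d₁, d₂, hd⟩ := h₂
  refine ⟨u * c₀ + v * d₀, u * c₁ + v * d₁, u * c₂ + v * d₂, ?_⟩
  have e : (g : K) * η =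
      (u : K) * (((g * N₁ : ℕ) : K) * η) + (v : K) * (((g * N₂ : ℕ) : K) * η) := by
    have := congrArg (fun t : ℤ => (t : K)) huv
    push_cast at this ⊢
    linear_combination -((g : K) * η) * this
  rw [e, hc, hd]
  push_cast
  ring

/-- **One Eisenstein side of Dedekind's theorem.** For `ab` squarefree, `ab ≠ 1`, `θ³ = ab²` in
a cubic field `K`: if `dN = 27a²b⁴` and every prime factor of `d` divides `a`, then
`N ξ ∈ ℤ[θ]` for every algebraic integer `ξ` (`27a²b⁴ = -disc(1, θ, θ²)` multiplies `𝓞 K` into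
`ℤ[θ]`, and `X³ - ab²` is Eisenstein at the primes of `d`). [cite: AlacaWilliams2003, Thm. 7.3.2] -/
theorem mul_mem_adjoin_of_dvd (h3 : finrank ℚ K = 3) (hab : Squarefree (a * b))
    (hab1 : a * b ≠ 1) (hθ : θ ^ 3 = ((a * b ^ 2 : ℕ) : K)) {d N : ℕ}
    (hdN : d * N = 27 * a ^ 2 * b ^ 4) (hd : ∀ p : ℕ, p.Prime → p ∣ d → p ∣ a) (ξ : 𝓞 K) :
    (N : K) * ξ ∈ Algebra.adjoin ℤ ({θ} : Set K) := by
  obtain ⟨ha0, hb0⟩ := ne_zero_of_squarefree_mul hab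
  have hpoly := aeval_poly_of_cube_eq hθ
  have hirr := irreducible_polyQ (not_cube hab hab1)
  have hd0 : d ≠ 0 := by rintro rfl; simp [ha0, hb0] at hdN
  have key := disc_mul_mem_adjoin hirr hpoly h3 ξ
  rw [disc_eq] at key
  have key' : (d : K) * ↑((N : 𝓞 K) * ξ) ∈ Algebra.adjoin ℤ ({θ} : Set K) := by
    rw [coe_natCast_mul_ringOfIntegers, ← mul_assoc, ← Nat.cast_mul, hdN]
    convert Subalgebra.neg_mem _ key using 1
    push_cast
    ring
  have := mem_adjoin_of_eisenstein_dvd h3 hirr hpoly hd0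
    (fun p hp hpd => isEisensteinAt_of_dvd hab hp (hd p hp hpd)) key'
  rwa [coe_natCast_mul_ringOfIntegers] at this

/-- The trace of an algebraic integer is a rational integer. [folklore] -/
theorem exists_int_trace_eq (η : 𝓞 K) : ∃ t : ℤ, Algebra.trace ℚ K (η : K) = t := by
  obtain ⟨t, ht⟩ := IsIntegrallyClosed.isIntegral_iff.mp
    (Algebra.isIntegral_trace (L := ℚ) (RingOfIntegers.isIntegral_coe η))
  exact ⟨t, by rw [← ht]; rfl⟩

/-- **Dedekind's theorem, up to index `3`: `3 · 𝓞 K ⊆ ℤ + ℤθ + ℤθ²/b`** for `ab` squarefree,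
`ab ≠ 1`, and a cubic number field `K ∋ θ`, `θ³ = ab²`. (`27b⁴ · 𝓞 K ⊆ ℤ[θ]` and
`27a⁴ · 𝓞 K ⊆ ℤ[θ²/b]` by the discriminant and Eisenstein at the primes of `a`, resp. `b`, so
`27 · 𝓞 K ⊆ 𝒪`, and `𝓞 K ⊆ 𝒪` when `3 ∣ ab`; for `3 ∤ ab` the traces of `ξ, θξ, θ₂ξ` show that
the coordinates of `27ξ` are divisible by `9`.) [cite: AlacaWilliams2003, Thm. 7.3.2] -/
theorem three_mul_mem_order (h3 : finrank ℚ K = 3) (hab : Squarefree (a * b))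
    (hab1 : a * b ≠ 1) (hθ : θ ^ 3 = ((a * b ^ 2 : ℕ) : K)) (ξ : 𝓞 K) :
    ∃ c₀ c₁ c₂ : ℤ, (3 : K) * (ξ : K) = c₀ + c₁ * θ + c₂ * (θ ^ 2 / (b : K)) := by
  obtain ⟨hcop, -, -⟩ := Nat.squarefree_mul_iff.mp hab
  have hba : Squarefree (b * a) := by rwa [mul_comm]
  have hba1 : b * a ≠ 1 := by rwa [mul_comm]
  -- the two Eisenstein sides, landing in `𝒪`
  have sideθ : ∀ {d N : ℕ}, d * N = 27 * a ^ 2 * b ^ 4 → (∀ p : ℕ, p.Prime → p ∣ d → p ∣ a) →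
      ∃ c₀ c₁ c₂ : ℤ, (N : K) * ξ = c₀ + c₁ * θ + c₂ * (θ ^ 2 / (b : K)) :=
    fun hdN hd => exists_coords_of_mem_adjoin_theta hab hθ
      (mul_mem_adjoin_of_dvd h3 hab hab1 hθ hdN hd ξ)
  have sideθ₂ : ∀ {d N : ℕ}, d * N = 27 * b ^ 2 * a ^ 4 → (∀ p : ℕ, p.Prime → p ∣ d → p ∣ b) →
      ∃ c₀ c₁ c₂ : ℤ, (N : K) * ξ = c₀ + c₁ * θ + c₂ * (θ ^ 2 / (b : K)) :=
    fun hdN hd => exists_coords_of_mem_adjoin_theta₂ hab hθ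
      (mul_mem_adjoin_of_dvd h3 hba hba1 (theta₂_pow_three hab hθ) hdN hd ξ)
  have hsq : ∀ {c : ℕ} (p : ℕ), p.Prime → p ∣ c ^ 2 → p ∣ c := fun p hp h => hp.dvd_of_dvd_pow h
  -- `27 ξ ∈ 𝒪` (Bézout on `a⁴`, `b⁴`)
  have h27 : ∃ x y z : ℤ, ((1 * 27 : ℕ) : K) * ξ = x + y * θ + z * (θ ^ 2 / (b : K)) := by
    rw [one_mul]
    exact of_coprime_mul (hcop.symm.pow 4 4) (sideθ (by ring) hsq) (sideθ₂ (by ring) hsq)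
  by_cases h3ab : 3 ∣ a * b
  · -- Eisenstein at `3` as well, on the side `3` divides: `ξ ∈ 𝒪`
    have hd27 : ∀ {c : ℕ}, 3 ∣ c → ∀ p : ℕ, p.Prime → p ∣ 27 * c ^ 2 → p ∣ c := by
      intro c h3c p hp h
      rcases (Nat.Prime.dvd_mul hp).mp h with h | h
      · rwa [(Nat.prime_dvd_prime_iff_eq hp Nat.prime_three).mp
          (hp.dvd_of_dvd_pow (show p ∣ 3 ^ 3 by simpa using h))]
      · exact hsq p hp h
    have hξ : ∃ c₀ c₁ c₂ : ℤ, ((1 : ℕ) : K) * ξ = c₀ + c₁ * θ + c₂ * (θ ^ 2 / (b : K)) := by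
      rcases (Nat.Prime.dvd_mul Nat.prime_three).mp h3ab with h3a | h3b
      · exact of_coprime_mul (Nat.Coprime.pow 4 3 (hcop.coprime_dvd_left h3a).symm)
          (sideθ (by ring) (hd27 h3a)) h27
      · exact of_coprime_mul (Nat.Coprime.pow 4 3 (hcop.symm.coprime_dvd_left h3b).symm)
          (sideθ₂ (by ring) (hd27 h3b)) h27
    obtain ⟨c₀, c₁, c₂, hc⟩ := hξ
    rw [Nat.cast_one, one_mul] at hc
    exact ⟨3 * c₀, 3 * c₁, 3 * c₂, by rw [hc]; push_cast; ring⟩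
  · -- `3 ∤ ab`: the traces of `ξ, θξ, θ₂ξ`
    obtain ⟨x, y, z, hxyz⟩ := h27
    push_cast at hxyz
    have hξeq : (ξ : K) = ((x / 27 : ℚ) : K) + ((y / 27 : ℚ) : K) * θ +
        ((z / 27 : ℚ) : K) * (θ ^ 2 / (b : K)) := by
      push_cast
      linear_combination (1 / 27 : K) * hxyz
    have h1 := theta_mul_theta₂ hab hθ
    push_cast at h1
    -- `θ ξ` and `θ₂ ξ` in the basis `1, θ, θ₂`
    have hθξ : ((⟨θ, isIntegral_theta hθ⟩ * ξ : 𝓞 K) : K) = (((a * b : ℕ) * z / 27 : ℚ) : K) +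
        ((x / 27 : ℚ) : K) * θ + ((b * y / 27 : ℚ) : K) * (θ ^ 2 / (b : K)) := by
      change θ * (ξ : K) = _
      rw [hξeq]
      push_cast
      linear_combination ((z : K) / 27) * h1 + ((y : K) / 27) * theta_sq (K := K) (θ := θ) hab
    have hθ₂ξ : ((⟨θ ^ 2 / (b : K), isIntegral_theta₂ hab hθ⟩ * ξ : 𝓞 K) : K) =
        (((a * b : ℕ) * y / 27 : ℚ) : K) + ((a * z / 27 : ℚ) : K) * θ +
          ((x / 27 : ℚ) : K) * (θ ^ 2 / (b : K)) := by
      change θ ^ 2 / (b : K) * (ξ : K) = _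
      rw [hξeq]
      push_cast
      linear_combination ((y : K) / 27) * h1 + ((z : K) / 27) * theta₂_sq hab hθ
    obtain ⟨t₀, ht₀⟩ := exists_int_trace_eq ξ
    obtain ⟨t₁, ht₁⟩ := exists_int_trace_eq (⟨θ, isIntegral_theta hθ⟩ * ξ)
    obtain ⟨t₂, ht₂⟩ := exists_int_trace_eq (⟨θ ^ 2 / (b : K), isIntegral_theta₂ hab hθ⟩ * ξ)
    rw [hξeq, trace_order h3 hab hab1 hθ] at ht₀
    rw [hθξ, trace_order h3 hab hab1 hθ] at ht₁
    rw [hθ₂ξ, trace_order h3 hab hab1 hθ] at ht₂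
    -- `x = 9 Tr(ξ)`, `abz = 9 Tr(θξ)`, `aby = 9 Tr(θ₂ξ)`, and `gcd(9, ab) = 1`
    have hx : x = 9 * t₀ := by
      have : (x : ℚ) = 9 * t₀ := by linear_combination 9 * ht₀
      exact_mod_cast this
    have h9 : ∀ {w t : ℤ}, (3 * ((a * b : ℕ) * w / 27) : ℚ) = t → (9 : ℤ) ∣ w := by
      intro w t ht
      have h9 : IsCoprime (9 : ℤ) ((a * b : ℕ) : ℤ) := by
        have := Nat.isCoprime_iff_coprime.mpr
          (Nat.Coprime.pow_left 2 ((Nat.Prime.coprime_iff_not_dvd Nat.prime_three).mpr h3ab))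
        exact_mod_cast this
      refine h9.dvd_of_dvd_mul_right ⟨t, ?_⟩
      have : ((w * ((a * b : ℕ) : ℤ) : ℤ) : ℚ) = 9 * t := by
        push_cast at ht ⊢
        linear_combination 9 * ht
      exact_mod_cast this
    obtain ⟨y', rfl⟩ := h9 ht₂
    obtain ⟨z', rfl⟩ := h9 ht₁
    subst hx
    refine ⟨t₀, y', z', ?_⟩
    push_cast at hxyz
    linear_combination (1 / 9 : K) * hxyz

end PureCubic

end Literature.NumberTheory.NumberFields

end
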